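import Mathlib
import HarnessLib
import Summits.Ventures.LatticeQCDFlow.Scaling.AutoregressiveGaugeRedundancyForest
import Summits.Ventures.LatticeQCDFlow.Scaling.AutoregressiveGaugePlaquetteReads
import Summits.Ventures.LatticeQCDFlow.Scaling.AutoregressiveGaugeForestAcceptance
import Literature.NumberTheory.Automorphic.AutomorphicRepsGLLogDetCounterexample

/-!
# LatticeQCDFlow / Scaling — EXTENSIVE TRAINING-LOSS FLOORS FOR CONTEXT-FREE PROPOSALS: both relative
# entropies between a lattice gauge theory and a proposal are at least the divergence between the
# proposal's FOREST marginal and the flat law; for independent links, `≥ Σ_{a ∈ T} KL(Haar‖q_a)` resp.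
# `≥ Σ_{a ∈ T} KL(q_a‖Haar)` — linear in the forest size

HONEST FRAMING: exact (Metropolis-corrected) sampling algorithms for lattice gauge theory;
figures of merit are autocorrelation/cost numbers at stated couplings and volumes; no
continuum-physics claim.

Venture `LatticeQCDFlow` (cell pub-lqcd), topic `Scaling`, FANOUT row 30 (lean-1, GEN-19) — OUR WORK on
THEORY-2.md §4 (how the TRAINING cost of an exact flow / autoregressive sampler scales with the VOLUME),
the relative-entropy companion of `Scaling/AutoregressiveGaugeForestAcceptance` (acceptance
`≤ e^{−2(L^d−1)h²}`), on GEN-15's `coordAvg_forest_eq_integral` (forest marginals of every lattice gauge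
theory are FLAT) and GEN-15 II's `integral_coordAvg_eq`.

## What is proved (all [ours])

* §1 (general product of a probability space) **`coordAvg_mul_log_div_ge`** — the LOG-SUM INEQUALITY
  along the integrated coordinates: for `f`, `g` squeezed between positive constants,
  `A_s(f·log(f/g)) ≥ A_s f · log(A_s f / A_s g)` (from `log x ≤ x − 1`; no convexity library).
* §2 (gauge configurations, compact `G`, Haar; gauge-invariant `F` with `0 < c_F ≤ F ≤ C_F`, `p = F/Z`;
  a pruning certificate `T` (forest), `s = (links of T)ᶜ`; a proposal density `Q` with `0 < c_Q ≤ Q ≤ C_Q`):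
  **`forest_kl_fwd_ge`** — `∫ p log(p/Q) dπ ≥ −∫ log(A_s Q) dπ` (`= KL(flat_T ‖ Q_T)`);
  **`forest_kl_rev_ge`** — `∫ Q log(Q/p) dπ ≥ ∫ A_s Q · log(A_s Q) dπ` (`= KL(Q_T ‖ flat_T)`).
  (For a CONTEXT-FREE proposal `Q(U) = ∏_a q_a(U_a)` these floors are `Σ_{a∈T} KL(Haar‖q_a)` resp.
  `Σ_{a∈T} KL(q_a‖Haar)` — the companion `Scaling/AutoregressiveGaugeForestLossSum`.)

READING (value-free): the training loss (either direction) of a model that draws gauge links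
independently is bounded below by a sum over the `L^d − 1` links of a spanning tree of one-link
divergences from Haar — EXTENSIVE IN THE VOLUME at every coupling and for every compact gauge group —
and any structure a model puts on a forest is pure loss (the forest marginal of the target is flat).
NOT CLAIMED: models with context; the flat model's loss (a free-energy difference, also extensive, not
typed here); anything on acceptance (see the companion; there is no KL ceiling on acceptance,
`Scaling/AcceptanceNoKLCeiling`).  No `def`, no `sorry`, nothing cited as a fact.
-/

noncomputable section

namespace Summit.Ventures.LatticeQCDFlow.Theory2.Autoregressive

open MeasureTheory Function Set
open Literature.MathematicalPhysics.QuantumFieldTheory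
open Summit.Ventures.LatticeQCDFlow.Exactness

/-! ## §1 General tools -/

section General

variable {ι : Type*} [Fintype ι] [DecidableEq ι] {X : Type*} [MeasurableSpace X]
variable (μ : Measure X) [IsProbabilityMeasure μ]

set_option maxHeartbeats 400000 in
/-- **THE LOG-SUM INEQUALITY ALONG THE INTEGRATED COORDINATES**: for measurable `f`, `g` squeezed between
positive constants, `A_s f · log(A_s f / A_s g) ≤ A_s (f·log(f/g))` pointwise. [ours] -/
theorem coordAvg_mul_log_div_ge (s : Finset ι) {f g : (ι → X) → ℝ} (hfm : Measurable f) {cf Cf : ℝ}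
    (hcf : 0 < cf) (hflo : ∀ ω, cf ≤ f ω) (hfhi : ∀ ω, f ω ≤ Cf) (hgm : Measurable g) {cg Cg : ℝ}
    (hcg : 0 < cg) (hglo : ∀ ω, cg ≤ g ω) (hghi : ∀ ω, g ω ≤ Cg) (ω : ι → X) :
    coordAvg μ s f ω * Real.log (coordAvg μ s f ω / coordAvg μ s g ω) ≤
      coordAvg μ s (fun η => f η * Real.log (f η / g η)) ω := by
  have hf0 : ∀ η, 0 < f η := fun η => hcf.trans_le (hflo η)
  have hg0 : ∀ η, 0 < g η := fun η => hcg.trans_le (hglo η)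
  have hCf : 0 < Cf := (hf0 ω).trans_le (hfhi ω)
  have hCg : 0 < Cg := (hg0 ω).trans_le (hghi ω)
  have hA := coordAvg_mem_Icc μ s hfm hflo hfhi ω
  have hB := coordAvg_mem_Icc μ s hgm hglo hghi ω
  set A : ℝ := coordAvg μ s f ω with hAdef
  set B : ℝ := coordAvg μ s g ω with hBdef
  have hA0 : 0 < A := hcf.trans_le hA.1
  have hB0 : 0 < B := hcg.trans_le hB.1
  set c : ℝ := A / B with hc
  have hc0 : 0 < c := div_pos hA0 hB0
  -- sections and integrability
  have hsec : ∀ {h : (ι → X) → ℝ} (_ : Measurable h) {C : ℝ} (_ : ∀ η, |h η| ≤ C),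
      Integrable (fun ω' : ι → X => h (s.piecewise ω' ω)) (Measure.pi fun _ : ι => μ) :=
    fun hh C hC => integrable_of_bounded_measurable
      (hh.comp ((measurable_piecewise_prod s).comp (measurable_const.prodMk measurable_id))) (fun ω' => hC _)
  have hfabs : ∀ η, |f η| ≤ Cf := fun η => by rw [abs_of_pos (hf0 η)]; exact hfhi η
  have hgabs : ∀ η, |g η| ≤ Cg := fun η => by rw [abs_of_pos (hg0 η)]; exact hghi η
  -- the ratio `r = c·g/f` is squeezed
  have hr0 : ∀ η, 0 < c * g η / f η := fun η => div_pos (mul_pos hc0 (hg0 η)) (hf0 η)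
  have hrhi : ∀ η, c * g η / f η ≤ c * Cg / cf := fun η =>
    div_le_div₀ (mul_nonneg hc0.le hCg.le) (mul_le_mul_of_nonneg_left (hghi η) hc0.le) hcf (hflo η)
  have hrlo : ∀ η, c * cg / Cf ≤ c * g η / f η := fun η =>
    div_le_div₀ (mul_nonneg hc0.le (hg0 η).le) (mul_le_mul_of_nonneg_left (hglo η) hc0.le) (hf0 η) (hfhi η)
  have hlm : Measurable fun η => f η * Real.log (c * g η / f η) :=
    hfm.mul (Real.measurable_log.comp (((measurable_const.mul hgm)).div hfm))
  have hlb : ∀ η, |f η * Real.log (c * g η / f η)| ≤ Cf * (c * Cg / cf + (c * cg / Cf)⁻¹) := fun η => by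
    rw [abs_mul, abs_of_pos (hf0 η)]
    refine mul_le_mul (hfhi η) ((Literature.NumberTheory.Automorphic.abs_log_le_add_inv (hr0 η)).trans (add_le_add (hrhi η) ?_))
      (abs_nonneg _) hCf.le
    exact inv_anti₀ (div_pos (mul_pos hc0 hcg) hCf) (hrlo η)
  -- the target integrand is `f·log c − f·log(c g/f)`
  have hsplit : ∀ η, f η * Real.log (f η / g η) = f η * Real.log c - f η * Real.log (c * g η / f η) := by
    intro η
    have e : Real.log (c * g η / f η) = Real.log c - Real.log (f η / g η) := by
      rw [Real.log_div (mul_pos hc0 (hg0 η)).ne' (hf0 η).ne', Real.log_mul hc0.ne' (hg0 η).ne',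
        Real.log_div (hf0 η).ne' (hg0 η).ne']
      ring
    rw [e]; ring
  -- `A_s (f·log(cg/f)) ≤ A_s (c g − f) = c B − A = 0`
  have hkey : coordAvg μ s (fun η => f η * Real.log (c * g η / f η)) ω ≤ 0 := by
    have hpt : ∀ η, f η * Real.log (c * g η / f η) ≤ c * g η - f η := by
      intro η
      have h := Real.log_le_sub_one_of_pos (hr0 η)
      have hfne : f η ≠ 0 := (hf0 η).ne'
      have e : f η * (c * g η / f η - 1) = c * g η - f η := by field_simp
      rw [← e]; exact mul_le_mul_of_nonneg_left h (hf0 η).le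
    calc coordAvg μ s (fun η => f η * Real.log (c * g η / f η)) ω
        ≤ coordAvg μ s (fun η => c * g η - f η) ω := by
          unfold coordAvg
          exact integral_mono (hsec hlm hlb) ((hsec hgm hgabs).const_mul c |>.sub (hsec hfm hfabs))
            (fun ω' => hpt _)
      _ = c * B - A := by
          unfold coordAvg
          rw [integral_sub ((hsec hgm hgabs).const_mul c) (hsec hfm hfabs), integral_const_mul]
          rfl
      _ = 0 := by rw [hc, div_mul_cancel₀ _ hB0.ne', sub_self]
  -- assemble
  have e1 : coordAvg μ s (fun η => f η * Real.log (f η / g η)) ω =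
      A * Real.log c - coordAvg μ s (fun η => f η * Real.log (c * g η / f η)) ω := by
    unfold coordAvg
    simp_rw [hsplit]
    rw [integral_sub ((hsec hfm hfabs).mul_const _) (hsec hlm hlb), integral_mul_const]
    rfl
  rw [e1]
  linarith

end General

/-! ## §2 Gauge configurations: both divergences see at least the forest marginal -/

section Gauge

variable {d L : ℕ} {G : Type*} [Group G] [TopologicalSpace G] [IsTopologicalGroup G] [CompactSpace G]
  [MeasurableSpace G] [BorelSpace G] [NeZero L]

/-- Bookkeeping for a squeezed weight on gauge configurations: `Z = ∫F dπ ≥ c_F > 0`. [ours] -/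
theorem integral_pos_of_le {F : GaugeConfig d L G → ℝ} (hFm : Measurable F) {cF CF : ℝ} (hcF : 0 < cF)
    (hFlo : ∀ U, cF ≤ F U) (hFhi : ∀ U, F U ≤ CF) :
    cF ≤ ∫ U, F U ∂Measure.pi (fun _ : Edge d L => haarProbability G) := by
  have hFabs : ∀ U, |F U| ≤ CF := fun U => by rw [abs_of_pos (hcF.trans_le (hFlo U))]; exact hFhi U
  have h1 : ∫ _, cF ∂Measure.pi (fun _ : Edge d L => haarProbability G) ≤
      ∫ U, F U ∂Measure.pi (fun _ : Edge d L => haarProbability G) :=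
    integral_mono (integrable_const cF) (integrable_of_bounded_measurable hFm hFabs) hFlo
  rwa [integral_const, smul_eq_mul, Measure.real, measure_univ, ENNReal.toReal_one, one_mul] at h1

set_option maxHeartbeats 400000 in
/-- **FORWARD: `D(p ‖ Q) ≥ KL(flat_T ‖ Q_T) = −∫ log(A_s Q) dπ`.**  Gauge-invariant `F` with
`0 < c_F ≤ F ≤ C_F`, `p = F/Z`; pruning certificate `T`, `s = (links of T)ᶜ`; proposal density `Q` with
`0 < c_Q ≤ Q ≤ C_Q`. [ours] -/
theorem forest_kl_fwd_ge {F : GaugeConfig d L G → ℝ} (hF : IsGaugeInvariant F) (hFm : Measurable F)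
    {cF CF : ℝ} (hcF : 0 < cF) (hFlo : ∀ U, cF ≤ F U) (hFhi : ∀ U, F U ≤ CF)
    (T : List (Edge d L × Site d L))
    (hinc : ∀ p ∈ T, (p.1.1 = p.2 ∨ p.1.1.shift p.1.2 = p.2) ∧ p.1.1 ≠ p.1.1.shift p.1.2)
    (hpw : T.Pairwise (fun p q => ¬ (q.1.1 = p.2 ∨ q.1.1.shift q.1.2 = p.2)))
    {Q : GaugeConfig d L G → ℝ} (hQm : Measurable Q) {cQ CQ : ℝ} (hcQ : 0 < cQ) (hQlo : ∀ U, cQ ≤ Q U)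
    (hQhi : ∀ U, Q U ≤ CQ) :
    -∫ U, Real.log (coordAvg (haarProbability G) (Finset.univ \ (T.map Prod.fst).toFinset) Q U)
        ∂Measure.pi (fun _ : Edge d L => haarProbability G) ≤
      ∫ U, F U / (∫ W, F W ∂Measure.pi (fun _ : Edge d L => haarProbability G)) *
        Real.log ((F U / ∫ W, F W ∂Measure.pi (fun _ : Edge d L => haarProbability G)) / Q U)
        ∂Measure.pi (fun _ : Edge d L => haarProbability G) := by
  set μ := haarProbability G with hμ
  set π := Measure.pi (fun _ : Edge d L => μ) with hπ
  set Z : ℝ := ∫ W, F W ∂π with hZdef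
  set s : Finset (Edge d L) := Finset.univ \ (T.map Prod.fst).toFinset with hs
  have hZlo : cF ≤ Z := integral_pos_of_le hFm hcF hFlo hFhi
  have hZ : 0 < Z := hcF.trans_le hZlo
  have hF0 : ∀ U, 0 < F U := fun U => hcF.trans_le (hFlo U)
  have hFabs : ∀ U, |F U| ≤ CF := fun U => by rw [abs_of_pos (hF0 U)]; exact hFhi U
  have hCF : 0 < CF := (hF0 1).trans_le (hFhi 1)
  have hQ0 : ∀ U, 0 < Q U := fun U => hcQ.trans_le (hQlo U)
  have hCQ : 0 < CQ := (hQ0 1).trans_le (hQhi 1)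
  -- `p = F/Z` is squeezed
  have hpm : Measurable fun U => F U / Z := hFm.div_const Z
  have hplo : ∀ U, cF / Z ≤ F U / Z := fun U => div_le_div_of_nonneg_right (hFlo U) hZ.le
  have hphi : ∀ U, F U / Z ≤ CF / Z := fun U => div_le_div_of_nonneg_right (hFhi U) hZ.le
  have hcp : 0 < cF / Z := div_pos hcF hZ
  -- `A_s p = 1`
  have hAp : ∀ U, coordAvg μ s (fun W => F W / Z) U = 1 := fun U => by
    have e : coordAvg μ s (fun W => F W / Z) U = coordAvg μ s F U / Z := integral_div Z _
    rw [e, hs, coordAvg_forest_eq_integral hF hFm ⟨CF, hFabs⟩ T hinc hpw U, ← hZdef, div_self hZ.ne']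
  -- the integrand `h = p log(p/Q)` is bounded measurable, `∫ h = ∫ A_s h`
  have hr0 : ∀ U, 0 < F U / Z / Q U := fun U => div_pos (hcp.trans_le (hplo U)) (hQ0 U)
  have hrb : ∀ U, cF / Z / CQ ≤ F U / Z / Q U ∧ F U / Z / Q U ≤ CF / Z / cQ := fun U =>
    ⟨div_le_div₀ (hcp.le.trans (hplo U)) (hplo U) (hQ0 U) (hQhi U),
      div_le_div₀ ((hcp.le.trans (hplo U)).trans (hphi U)) (hphi U) hcQ (hQlo U)⟩
  have hhm : Measurable fun U => F U / Z * Real.log (F U / Z / Q U) := hpm.mul (Real.measurable_log.comp (hpm.div hQm))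
  have hhb : ∃ C, ∀ U, |F U / Z * Real.log (F U / Z / Q U)| ≤ C :=
    ⟨CF / Z * (CF / Z / cQ + (cF / Z / CQ)⁻¹), fun U => by
      rw [abs_mul, abs_of_pos (hcp.trans_le (hplo U))]
      refine mul_le_mul (hphi U) ((Literature.NumberTheory.Automorphic.abs_log_le_add_inv (hr0 U)).trans
        (add_le_add (hrb U).2 (inv_anti₀ (div_pos hcp hCQ) (hrb U).1))) (abs_nonneg _)
        ((hcp.le.trans (hplo U)).trans (hphi U))⟩
  have htot := integral_coordAvg_eq μ s hhm hhb
  -- pointwise log-sum on each fibre, then integrate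
  have hpt : ∀ U, -Real.log (coordAvg μ s Q U) ≤ coordAvg μ s (fun W => F W / Z * Real.log (F W / Z / Q W)) U := by
    intro U
    have h := coordAvg_mul_log_div_ge μ s hpm hcp hplo hphi hQm hcQ hQlo hQhi U
    rw [hAp U, one_mul, one_div, Real.log_inv] at h
    exact h
  have hAQm : Measurable (coordAvg μ s Q) := measurable_coordAvg μ s hQm
  have hAQb : ∀ U, cQ ≤ coordAvg μ s Q U ∧ coordAvg μ s Q U ≤ CQ := fun U => coordAvg_mem_Icc μ s hQm hQlo hQhi U
  have hlogb : ∀ U, |(-Real.log (coordAvg μ s Q U))| ≤ CQ + cQ⁻¹ := fun U => by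
    rw [abs_neg]
    exact (Literature.NumberTheory.Automorphic.abs_log_le_add_inv (hcQ.trans_le (hAQb U).1)).trans
      (add_le_add (hAQb U).2 (inv_anti₀ hcQ (hAQb U).1))
  obtain ⟨Ch, hCh⟩ := hhb
  have hAhm : Measurable (coordAvg μ s (fun W => F W / Z * Real.log (F W / Z / Q W))) := measurable_coordAvg μ s hhm
  have hAhb : ∀ U, |coordAvg μ s (fun W => F W / Z * Real.log (F W / Z / Q W)) U| ≤ Ch := fun U =>
    abs_le.2 (coordAvg_mem_Icc μ s hhm (fun W => (abs_le.1 (hCh W)).1) (fun W => (abs_le.1 (hCh W)).2) U)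
  rw [← htot, ← integral_neg]
  exact integral_mono (integrable_of_bounded_measurable hAQm.log.neg hlogb) (integrable_of_bounded_measurable hAhm hAhb) hpt

set_option maxHeartbeats 400000 in
/-- **REVERSE (the flow's training loss): `D(Q ‖ p) ≥ KL(Q_T ‖ flat_T) = ∫ A_s Q · log(A_s Q) dπ`.**
Same setting. [ours] -/
theorem forest_kl_rev_ge {F : GaugeConfig d L G → ℝ} (hF : IsGaugeInvariant F) (hFm : Measurable F)
    {cF CF : ℝ} (hcF : 0 < cF) (hFlo : ∀ U, cF ≤ F U) (hFhi : ∀ U, F U ≤ CF)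
    (T : List (Edge d L × Site d L))
    (hinc : ∀ p ∈ T, (p.1.1 = p.2 ∨ p.1.1.shift p.1.2 = p.2) ∧ p.1.1 ≠ p.1.1.shift p.1.2)
    (hpw : T.Pairwise (fun p q => ¬ (q.1.1 = p.2 ∨ q.1.1.shift q.1.2 = p.2)))
    {Q : GaugeConfig d L G → ℝ} (hQm : Measurable Q) {cQ CQ : ℝ} (hcQ : 0 < cQ) (hQlo : ∀ U, cQ ≤ Q U)
    (hQhi : ∀ U, Q U ≤ CQ) :
    ∫ U, coordAvg (haarProbability G) (Finset.univ \ (T.map Prod.fst).toFinset) Q U *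
        Real.log (coordAvg (haarProbability G) (Finset.univ \ (T.map Prod.fst).toFinset) Q U)
        ∂Measure.pi (fun _ : Edge d L => haarProbability G) ≤
      ∫ U, Q U * Real.log (Q U / (F U / ∫ W, F W ∂Measure.pi (fun _ : Edge d L => haarProbability G)))
        ∂Measure.pi (fun _ : Edge d L => haarProbability G) := by
  set μ := haarProbability G with hμ
  set π := Measure.pi (fun _ : Edge d L => μ) with hπ
  set Z : ℝ := ∫ W, F W ∂π with hZdef
  set s : Finset (Edge d L) := Finset.univ \ (T.map Prod.fst).toFinset with hs
  have hZlo : cF ≤ Z := integral_pos_of_le hFm hcF hFlo hFhi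
  have hZ : 0 < Z := hcF.trans_le hZlo
  have hF0 : ∀ U, 0 < F U := fun U => hcF.trans_le (hFlo U)
  have hFabs : ∀ U, |F U| ≤ CF := fun U => by rw [abs_of_pos (hF0 U)]; exact hFhi U
  have hQ0 : ∀ U, 0 < Q U := fun U => hcQ.trans_le (hQlo U)
  have hCQ : 0 < CQ := (hQ0 1).trans_le (hQhi 1)
  have hpm : Measurable fun U => F U / Z := hFm.div_const Z
  have hplo : ∀ U, cF / Z ≤ F U / Z := fun U => div_le_div_of_nonneg_right (hFlo U) hZ.le
  have hphi : ∀ U, F U / Z ≤ CF / Z := fun U => div_le_div_of_nonneg_right (hFhi U) hZ.le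
  have hcp : 0 < cF / Z := div_pos hcF hZ
  have hCp : 0 < CF / Z := hcp.trans_le ((hplo 1).trans (hphi 1))
  have hAp : ∀ U, coordAvg μ s (fun W => F W / Z) U = 1 := fun U => by
    have e : coordAvg μ s (fun W => F W / Z) U = coordAvg μ s F U / Z := integral_div Z _
    rw [e, hs, coordAvg_forest_eq_integral hF hFm ⟨CF, hFabs⟩ T hinc hpw U, ← hZdef, div_self hZ.ne']
  -- the integrand `h = Q log(Q/p)`
  have hr0 : ∀ U, 0 < Q U / (F U / Z) := fun U => div_pos (hQ0 U) (hcp.trans_le (hplo U))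
  have hrb : ∀ U, cQ / (CF / Z) ≤ Q U / (F U / Z) ∧ Q U / (F U / Z) ≤ CQ / (cF / Z) := fun U =>
    ⟨div_le_div₀ (hcQ.le.trans (hQlo U)) (hQlo U) (hcp.trans_le (hplo U)) (hphi U),
      div_le_div₀ ((hcQ.le.trans (hQlo U)).trans (hQhi U)) (hQhi U) hcp (hplo U)⟩
  have hhm : Measurable fun U => Q U * Real.log (Q U / (F U / Z)) := hQm.mul (Real.measurable_log.comp (hQm.div hpm))
  have hhb : ∃ C, ∀ U, |Q U * Real.log (Q U / (F U / Z))| ≤ C :=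
    ⟨CQ * (CQ / (cF / Z) + (cQ / (CF / Z))⁻¹), fun U => by
      rw [abs_mul, abs_of_pos (hQ0 U)]
      exact mul_le_mul (hQhi U) ((Literature.NumberTheory.Automorphic.abs_log_le_add_inv (hr0 U)).trans
        (add_le_add (hrb U).2 (inv_anti₀ (div_pos hcQ hCp) (hrb U).1))) (abs_nonneg _) hCQ.le⟩
  have htot := integral_coordAvg_eq μ s hhm hhb
  have hpt : ∀ U, coordAvg μ s Q U * Real.log (coordAvg μ s Q U) ≤
      coordAvg μ s (fun W => Q W * Real.log (Q W / (F W / Z))) U := by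
    intro U
    have h := coordAvg_mul_log_div_ge μ s hQm hcQ hQlo hQhi hpm hcp hplo hphi U
    rw [hAp U, div_one] at h
    exact h
  have hAQm : Measurable (coordAvg μ s Q) := measurable_coordAvg μ s hQm
  have hAQb : ∀ U, cQ ≤ coordAvg μ s Q U ∧ coordAvg μ s Q U ≤ CQ := fun U => coordAvg_mem_Icc μ s hQm hQlo hQhi U
  have hlb : ∀ U, |coordAvg μ s Q U * Real.log (coordAvg μ s Q U)| ≤ CQ * (CQ + cQ⁻¹) := fun U => by
    rw [abs_mul, abs_of_pos (hcQ.trans_le (hAQb U).1)]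
    exact mul_le_mul (hAQb U).2 ((Literature.NumberTheory.Automorphic.abs_log_le_add_inv (hcQ.trans_le (hAQb U).1)).trans
      (add_le_add (hAQb U).2 (inv_anti₀ hcQ (hAQb U).1))) (abs_nonneg _) hCQ.le
  obtain ⟨Ch, hCh⟩ := hhb
  have hAhm : Measurable (coordAvg μ s (fun W => Q W * Real.log (Q W / (F W / Z)))) := measurable_coordAvg μ s hhm
  have hAhb : ∀ U, |coordAvg μ s (fun W => Q W * Real.log (Q W / (F W / Z))) U| ≤ Ch := fun U =>
    abs_le.2 (coordAvg_mem_Icc μ s hhm (fun W => (abs_le.1 (hCh W)).1) (fun W => (abs_le.1 (hCh W)).2) U)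
  rw [← htot]
  exact integral_mono (integrable_of_bounded_measurable (hAQm.mul hAQm.log) hlb) (integrable_of_bounded_measurable hAhm hAhb) hpt

end Gauge


end Summit.Ventures.LatticeQCDFlow.Theory2.Autoregressive

end
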